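import Literature.MathematicalPhysics.QuantumFieldTheory.Balaban1983to89.B5Phi176Torus
import Literature.MathematicalPhysics.QuantumFieldTheory.Balaban1983to89.B5Identities197Torus

/-!
# `Balaban1983to89.B5Eq194DivG` — T. Bałaban, *Propagators and renormalization transformations for
# lattice gauge theories. I*, Commun. Math. Phys. **95** (1984) 17–40 [Balaban1984PropagatorsI]:
# the explicit formulas (1.94) for `∂*GQ*` and (1.96) for `∂*G∂` (Sect. E, p. 33), PROVED for the
# concrete torus operators (`G = Δ_a⁻¹`), by the printed road (1.73) ⟹ (1.75)/(1.77) ⟹ (1.80); and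
# the printed step «so RΔ⁻¹Q′* = 0» by which (1.95)/(1.97) follow from them

statement-level skeleton of published theorems with citation tags; proofs where landed; nothing here is a claim about the Yang–Mills mass gap

PDF held: `paper:balaban1984-cmp95-propagators-rt-i` (journal page = PDF page + 16); pp. 30–31, 33–34 read
this session from the page renders `1984-cmp95-propagators-rt-I-p014-x4.png`, `-p015-x4.png`,
`-p017-x4.png`, `-p018-x2.png` (not from OCR).

WHAT IS REPRODUCED.  SKELETON rows **B5.Eq1.95** (member (1.94)) and **B5.Eq1.97** (member (1.96)) of
`run/shared/lean/pub/lit-balaban/SKELETON.md` — the two displays of block B5 left untranscribed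
(`ROWS-B5.md` v2.0 «Block B5 residue»; `B5Identities197Torus` and `Beta.LandauMultiplierIdentities`
headers: «NOT CLAIMED: (1.94), (1.96)»).  Phase-2 seat **p37** (gen 3) of `PHASE2-TARGETS.md` §G (cell
`lit-balaban`, unit `lit-balaban-p37`, HOME `run/shared/lean/pub/lit-balaban/`).  Kind «model-instance /
identity»: the concrete operators are those of `B5DeltaA169`/`B5Identities197Torus`.

## The printed text (p. 30, p. 33; verbatim)

p. 30: «Applying the operator QΔ⁻¹ to (1.73) and using (1.55) we get
  QA − ∂₁Q′Δ⁻¹∂*A + aQΔ⁻¹Q*QA = QΔ⁻¹J.   (1.75)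
Of course ⟨1, QA⟩ = ⟨1, QΔ⁻¹J⟩ = 0. Let us denote  φ = I + aQΔ⁻¹Q*.   (1.76)
It is a well-defined and positive operator on the subspace of vector functions defined on the unit
lattice T₁^{(k)} and orthogonal to constant functions. Applying φ⁻¹ to (1.75) we get
  QA = φ⁻¹∂₁Q′Δ⁻¹∂*A + φ⁻¹QΔ⁻¹J.   (1.77)»
p. 31: «Q′Δ⁻¹∂*A = (∂₁*φ⁻¹∂₁)⁻¹[a⁻¹(Q′Δ⁻²Q′*)⁻¹Q′Δ⁻²∂*J − ∂₁*φ⁻¹QΔ⁻¹J].   (1.80)»;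
(1.84): «φ_μ(p′) = 1 + aΣ_{l″}|u(p′+l″)|²|v_μ(p′+l″)|²/Δ(p′+l″) for p′ ≠ 0.»
p. 33: «Let us calculate the operators R∂*GQ* and R∂*G∂. The operator ∂*GQ* acting on a constant
configuration gives 0, so we have to calculate it on configurations orthogonal to constant
configurations. Q* transforms them into configurations on the η-lattice and orthogonal to constant
configurations. On such configurations G is given by the formula (1.81), and we have
  ∂*GQ* = ∂*Δ⁻¹Q* − a∂*Δ⁻¹Q*φ⁻¹QΔ⁻¹Q*
      + [Δ⁻¹Q′*(Q′Δ⁻²Q′*)⁻¹ − a∂*Δ⁻¹Q*φ⁻¹∂₁]·a⁻¹(∂₁*φ⁻¹∂₁)⁻¹[∂₁* − a∂₁*φ⁻¹QΔ⁻¹Q*]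
    = Δ⁻¹Q′*∂₁*φ⁻¹ + Δ⁻¹Q′*[(Q′Δ⁻²Q′*)⁻¹ − a∂₁*φ⁻¹∂₁]·a⁻¹(∂₁*φ⁻¹∂₁)⁻¹·∂₁*φ⁻¹
    = Δ⁻¹Q′*(Q′Δ⁻²Q′*)⁻¹a⁻¹(∂₁*φ⁻¹∂₁)⁻¹∂₁*φ⁻¹.   (1.94)
The operator R is given by the formula R = I − P = I − Δ⁻¹Q′*·(Q′Δ⁻²Q′*)⁻¹Q′Δ⁻¹, so RΔ⁻¹Q′* = 0 and
we have  R∂*GQ* = 0, QG∂R = 0.   (1.95)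
Calculating ∂*G∂ we get the formula
  ∂*G∂ = I + Δ⁻¹Q′*[(Q′Δ⁻²Q′*)⁻¹a⁻¹(∂₁*φ⁻¹∂₁)⁻¹(Q′Δ⁻²Q′*)⁻¹ − 2(Q′Δ⁻²Q′*)⁻¹]Q′Δ⁻¹,   (1.96)»
p. 34: «and from this it follows that  R∂*G∂ = ∂*G∂R = R.   (1.97)»

## Dictionary (the tree's typed torus operators; `T_η = Tor (fine n M)`, unit lattice `T₁^{(k)} = Tor M`,
`n = L^k`, any `d`, `n ≥ 1`, `M_μ ≥ 1`, `a > 0`)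

`∂ = GradOp (fine n M) n`, `∂* = ∂ᴴ`, `∂₁ = GradOp M 1`, `∂₁* = ∂₁ᴴ`, scalar `Δ⁻¹ = LapSinv (fine n M) n`
and componentwise `Δ⁻¹ = B5Phi162Torus.LapVinv` (value `0` on constants, p. 22), `Q = QvOp`, `Q* = QvAdj`,
`Q′ = QsOp`, `Q′* = B5Hk160Torus.QsAdj` (the (1.21)-weighted adjoint), `(Q′Δ⁻²Q′*)⁻¹ = B5Hk160Torus.Einv`
(on `1^⊥`, p. 22), `P = B5Value126.PcT` ((1.70)), `R = B5Identities197Torus.RT` (the p. 25 projection; `= I − P`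
in front of `∂*` and behind `∂`), `Δ_a = B5DeltaA169.DeltaA`, `G = (DeltaA)⁻¹` ((1.71); `= calG`).
From the support module `B5Phi176Torus` (this seat): the Sect. E `φ` of (1.76) `Phi176 = 1 + a•PhiOp`
(`PhiOp = QΔ⁻¹Q*` is the Sect. D `φ` of (1.58) — a DIFFERENT operator; both are printed «φ»), its symbol
(1.84) `phi184`, `φ⁻¹ = Phi176Inv`, `∂₁*φ⁻¹∂₁ = GPhiE`, `(∂₁*φ⁻¹∂₁)⁻¹ = GPhiEInv` (on `1^⊥`), and the
mechanism «RΔ⁻¹Q′* = 0» (`oneSubPcT_LapSinv_QsAdj`).  This file declares NO `def`: theorems only.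

## What is certified (kernel, zero `sorry`, axioms ⊆ {propext, Classical.choice, Quot.sound})

* §3 (§§1–2 = `B5Phi176Torus`) THE PRINTED ROAD for `Δ_aA = J`, `A, J ⊥` constants: **(1.75)** `eq175`, **(1.77)** `eq177`, the
  divergence of (1.73) `divS_eq173`, **(1.78)** (`∂*`-component) `divS_eq178`, and **(1.80)** `eq180`.
* §4 **(1.94)**: `∂*GQ* =` line 2 `=` line 3 (`divS_G_QvAdj_eq_line2/3`), and line 1 `=` line 2
  (`line1_eq_line2`), as MATRIX identities on all of `L²(T₁^{(k)}; ℂ^d)` (on constants every line is `0`,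
  as print says); `eq194` = the printed final form `∂*GQ* = Δ⁻¹Q′*(Q′Δ⁻²Q′*)⁻¹a⁻¹(∂₁*φ⁻¹∂₁)⁻¹∂₁*φ⁻¹`.
* §5 **(1.96)** on scalars `λ ⊥ 1` verbatim (`eq196_mulVec_of_orth`), and as a matrix identity on all of
  `L²(T_η)` with `I` read as `I − P_const` (`eq196`; on the constants `∂*G∂` is `0`, so the literal `I` is
  the identity OF THE SUBSPACE «orthogonal to constant configurations» on which p. 33 computes — the same
  reading as `B5Identities197Torus.RT` for `R`).
* §6 **(1.95), (1.97) FROM (1.94), (1.96) AS PRINTED**: the printed reason «so RΔ⁻¹Q′* = 0»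
  (`RT_mul_LapSinv_mul_QsAdj`, adjoint `QsOp_mul_LapSinv_mul_RT`; `RT_mul_Pker`, `Pker_mul_RT`), and four
  kernel-checked `example`s deriving (1.95) `R∂*GQ* = 0`, `QG∂R = 0` and (1.97) `R∂*G∂ = ∂*G∂R = R` from
  `eq194`/`eq196` in two rewrites each.  Those four matrix statements are the decls of record
  `B5Identities197Torus.eq195_left/right`, `eq197_left/right` (p21, proved there through the abstract
  `B5Identities197` algebra; the β cell's `Beta.LandauMultiplierIdentities` proves them by a third road) and
  are deliberately NOT re-declared here.  This file declares no `def`.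

HONEST SCOPE.  (1.81)/(1.83) themselves (the full formula for `G`) are not re-transcribed in position
space (`B5Prop11Inverse` certifies them fibrewise); the computation uses exactly the part of the printed
road that (1.94)/(1.96) need, namely (1.75)–(1.80) for `J = Q*ω` and `J = ∂λ` — which IS «substituting
(1.81)» restricted to its `∂*`-component.  Finite torus (periods `n·M_μ`) instead of the printed `T_η` with
`L′_μ → ∞`; complex fields; unitary DFT.  NOT summit progress.
-/

open scoped BigOperators Matrix ComplexConjugate
open Finset Complex

namespace Literature.MathematicalPhysics.QuantumFieldTheory.Balaban1983to89.B5Eq194DivG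

open Literature.MathematicalPhysics.QuantumFieldTheory.Balaban1983to89
open Literature.MathematicalPhysics.QuantumFieldTheory.Balaban1983to89.B5Prop11Plancherel (Tor dft fine sOf
  sOf_zero)
open Literature.MathematicalPhysics.QuantumFieldTheory.Balaban1983to89.B5Prop11Lower (Lap)
open Literature.MathematicalPhysics.QuantumFieldTheory.Balaban1983to89.B5Action121 (comp sdiff LapS GradOp
  divS GradOp_conjTranspose_mul_GradOp GradOp_conjTranspose_mulVec_eq GradOp_mulVec)
open Literature.MathematicalPhysics.QuantumFieldTheory.Balaban1983to89.B5Block118 (QsOp QvOp cT)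
open Literature.MathematicalPhysics.QuantumFieldTheory.Balaban1983to89.B5LaplaceInverse (ssym lsym LapSinv
  Pker LapS_mul_LapSinv LapSinv_mul_LapS LapSinv_mul_Pker Pker_mul_LapSinv LapS_mul_Pker Pker_mul_Pker
  Pker_conjTranspose LapSinv_conjTranspose Pker_orth LapS_LapSinv_of_orth LapSinv_LapS_of_orth
  LapSinv_const sum_LapSinv)
open Literature.MathematicalPhysics.QuantumFieldTheory.Balaban1983to89.B5LaplaceSpectral (sdiff_const)
open Literature.MathematicalPhysics.QuantumFieldTheory.Balaban1983to89.B5Momentum130 (dft_zero_apply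
  lsym_zero lsym_eq_zero_iff dft_LapS_apply)
open Literature.MathematicalPhysics.QuantumFieldTheory.Balaban1983to89.B5Momentum133 (dft_LapSinv_apply)
open Literature.MathematicalPhysics.QuantumFieldTheory.Balaban1983to89.B5DeltaA169 (QvAdj QvAdj_mulVec
  DeltaA isUnit_DeltaA dft_comp_GradOp dft_GradOp_adjoint)
open Literature.MathematicalPhysics.QuantumFieldTheory.Balaban1983to89.B5Substitution125 (Mop Minv
  Mop_mulVec Mop_Minv_of_orth Minv_Mop_of_orth QsOp_adjoint_orth QsOp_adjoint_const QsOp_orth)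
open Literature.MathematicalPhysics.QuantumFieldTheory.Balaban1983to89.B5Value126 (PcT PcT_mulVec
  PcT_conjTranspose sum_QsOp_LapSinv sum_Minv_of_orth)
open Literature.MathematicalPhysics.QuantumFieldTheory.Balaban1983to89.B5DivOrth (sum_GradOp_adjoint
  sum_LapS)
open Literature.MathematicalPhysics.QuantumFieldTheory.Balaban1983to89.B5Hk163Torus (dft_mulVec_injective)
open Literature.MathematicalPhysics.QuantumFieldTheory.Balaban1983to89.B5Bounds167Lattice (phi162
  phi162_nonneg)
open Literature.MathematicalPhysics.QuantumFieldTheory.Balaban1983to89.B5Phi162Torus (comp_smul eq_of_comp_eq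
  OrthConst dft_comp_zero_of_orthConst orthConst_of_dft_comp_zero dft_const_of_ne cMul dft_cMul LapVinv
  comp_LapVinv_mulVec PhiOp PhiOp_mulVec dft_PhiOp PhiOp_mulVec_const orthConst_PhiOp_mulVec)
open Literature.MathematicalPhysics.QuantumFieldTheory.Balaban1983to89.B5Hk160Torus (sum_eq_zero_iff_dft_zero
  sMul dft_sMul ssym_zero divS_GradOp_mulVec orthConst_GradOp constV divS_constV orthConst_sub dft_comp_Lap
  Lap_LapVinv_of_orthConst divS_LapVinv Lap_GradOp_mulVec QvAdj_constV QvOp_constV Lap_constV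
  orthConst_QvAdj B0 Bp orthConst_Bp Bp_add_B0 QvOp_GradOp_mulVec QsAdj divS_QvAdj Einv QsAdj_Einv
  QsOp_LapSinv2_QsAdj_Einv)
open Literature.MathematicalPhysics.QuantumFieldTheory.Balaban1983to89.B5Lagrange149Torus
  (Einv_QsOp_LapSinv2_QsAdj)
open Literature.MathematicalPhysics.QuantumFieldTheory.Balaban1983to89.B5Phi176Torus (Phi176 phi184
  Phi176_mulVec dft_Phi176 phi184_pos phi184_ne_zero Phi176Inv dft_Phi176Inv Phi176_Phi176Inv_mulVec
  Phi176Inv_Phi176_mulVec Phi176Inv_eq_sub Phi176_constV Phi176Inv_constV GPhiE GPhiE_mulVec gsymE GPhiEInv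
  GPhiE_GPhiEInv_of_orth GPhiEInv_GPhiE_of_orth sum_GPhiEInv sum_GPhiE LapVinv_Lap_of_orthConst LapVinv_GradOp
  orthConst_Lap DeltaA_mulVec' orthConst_of_DeltaA_eq DeltaA_constV G_constV divS_G_QvAdj_constV QsAdj_const
  PcT_LapSinv_QsAdj oneSubPcT_LapSinv_QsAdj)
open Literature.MathematicalPhysics.QuantumFieldTheory.Balaban1983to89.Beta.VectorPropagatorDict
  (ext_of_mulVec')
open Literature.MathematicalPhysics.QuantumFieldTheory.Balaban1983to89.Beta.LandauMultiplierIdentities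
  (GradOp_adjoint_mul_DeltaA GradOp_adjoint_mul_QvAdj sum_PcT_mulVec PcT_mul_Pker sum_Pker_mulVec
  QvAdj_conjTranspose)
open Literature.MathematicalPhysics.QuantumFieldTheory.Balaban1983to89.B5Identities197Torus (RT
  RT_mul_GradOp_adjoint GradOp_mul_RT RT_conjTranspose)

noncomputable section

variable {d : ℕ} (n : ℕ) [NeZero n] (M : Fin d → ℕ) [hM : ∀ μ, NeZero (M μ)] (a : ℝ)

/-! ## §3 The printed road for `Δ_aA = J`: (1.75), (1.77), the divergence of (1.73), (1.80) -/

/-- **(1.75)** «Applying the operator QΔ⁻¹ to (1.73) and using (1.55) we get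
QA − ∂₁Q′Δ⁻¹∂*A + aQΔ⁻¹Q*QA = QΔ⁻¹J» — for `Δ_aA = J` with `A ⊥` constants (p. 30 «From now on we will
assume that each component of A and J is orthogonal to constant functions»; `Q′Δ⁻¹P = Q′Δ⁻¹` by (1.70)).
[cite: Balaban1984PropagatorsI, (1.75) p.30] -/
theorem eq175 {A J : Tor (fine n M) × Fin d → ℂ} (hA : DeltaA n M a *ᵥ A = J)
    (hAo : OrthConst (fine n M) A) :
    QvOp n M *ᵥ A
      - GradOp M 1 *ᵥ (QsOp n M *ᵥ (LapSinv (fine n M) (n : ℂ) *ᵥ ((GradOp (fine n M) (n : ℂ))ᴴ *ᵥ A)))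
      + (a : ℂ) • (QvOp n M *ᵥ (LapVinv n M *ᵥ (QvAdj n M *ᵥ (QvOp n M *ᵥ A))))
      = QvOp n M *ᵥ (LapVinv n M *ᵥ J) := by
  have hnc : (n : ℂ) ≠ 0 := by exact_mod_cast NeZero.ne n
  have h : QvOp n M *ᵥ (LapVinv n M *ᵥ (DeltaA n M a *ᵥ A)) = QvOp n M *ᵥ (LapVinv n M *ᵥ J) := by
    rw [hA]
  rw [DeltaA_mulVec', Matrix.mulVec_add, Matrix.mulVec_sub, Matrix.mulVec_smul, Matrix.mulVec_add,
    Matrix.mulVec_sub, Matrix.mulVec_smul, LapVinv_Lap_of_orthConst n M hAo, LapVinv_GradOp,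
    QvOp_GradOp_mulVec] at h
  have hP : QsOp n M *ᵥ (LapSinv (fine n M) (n : ℂ) *ᵥ (PcT n M (n : ℂ) *ᵥ
        ((GradOp (fine n M) (n : ℂ))ᴴ *ᵥ A)))
      = QsOp n M *ᵥ (LapSinv (fine n M) (n : ℂ) *ᵥ ((GradOp (fine n M) (n : ℂ))ᴴ *ᵥ A)) := by
    rw [PcT_mulVec, ← Mop_mulVec, Mop_Minv_of_orth n M (n : ℂ) hnc _ (sum_QsOp_LapSinv n M (n : ℂ) _)]
  rw [hP] at h
  exact h

/-- **(1.77)** «Applying φ⁻¹ to (1.75) we get QA = φ⁻¹∂₁Q′Δ⁻¹∂*A + φ⁻¹QΔ⁻¹J» (`a ≥ 0`).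
[cite: Balaban1984PropagatorsI, (1.77) p.30] -/
theorem eq177 (ha : 0 ≤ a) {A J : Tor (fine n M) × Fin d → ℂ} (hA : DeltaA n M a *ᵥ A = J)
    (hAo : OrthConst (fine n M) A) :
    QvOp n M *ᵥ A
      = Phi176Inv n M a *ᵥ (GradOp M 1 *ᵥ (QsOp n M *ᵥ (LapSinv (fine n M) (n : ℂ) *ᵥ
          ((GradOp (fine n M) (n : ℂ))ᴴ *ᵥ A))))
        + Phi176Inv n M a *ᵥ (QvOp n M *ᵥ (LapVinv n M *ᵥ J)) := by
  have h := eq175 n M a hA hAo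
  have hΦ : Phi176 n M a *ᵥ (QvOp n M *ᵥ A)
      = GradOp M 1 *ᵥ (QsOp n M *ᵥ (LapSinv (fine n M) (n : ℂ) *ᵥ ((GradOp (fine n M) (n : ℂ))ᴴ *ᵥ A)))
        + QvOp n M *ᵥ (LapVinv n M *ᵥ J) := by
    rw [Phi176_mulVec, PhiOp_mulVec, ← h]
    abel
  calc QvOp n M *ᵥ A = Phi176Inv n M a *ᵥ (Phi176 n M a *ᵥ (QvOp n M *ᵥ A)) :=
        (Phi176Inv_Phi176_mulVec n M a ha _).symm
    _ = _ := by rw [hΦ, Matrix.mulVec_add]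

/-- **«apply ∂* to (1.73)»** (the computation of p. 30 behind (1.78)–(1.80)):
`Δ(∂*A) − Q′*(Q′Δ⁻²Q′*)⁻¹Q′Δ⁻¹(∂*A) + aQ′*∂₁*(QA) = ∂*J` for `Δ_aA = J` — using `∂*∂*∂… `: `∂*(∂*∂) = 0`,
`∂*∂ = Δ`, `ΔP = Q′*(Q′Δ⁻²Q′*)⁻¹Q′Δ⁻¹` on `∂*A`, and (1.55)* `∂*Q* = Q′*∂₁*`.
[cite: Balaban1984PropagatorsI, (1.73) p.30, (1.78) p.30] -/
theorem divS_eq173 {A J : Tor (fine n M) × Fin d → ℂ} (hA : DeltaA n M a *ᵥ A = J) :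
    LapS (fine n M) (n : ℂ) *ᵥ ((GradOp (fine n M) (n : ℂ))ᴴ *ᵥ A)
      - QsAdj n M *ᵥ (Einv n M *ᵥ (QsOp n M *ᵥ (LapSinv (fine n M) (n : ℂ) *ᵥ
          ((GradOp (fine n M) (n : ℂ))ᴴ *ᵥ A))))
      + (a : ℂ) • (QsAdj n M *ᵥ ((GradOp M 1)ᴴ *ᵥ (QvOp n M *ᵥ A)))
      = (GradOp (fine n M) (n : ℂ))ᴴ *ᵥ J := by
  have hnc : (n : ℂ) ≠ 0 := by exact_mod_cast NeZero.ne n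
  have key : ((GradOp (fine n M) (n : ℂ))ᴴ * DeltaA n M a) *ᵥ A = (GradOp (fine n M) (n : ℂ))ᴴ *ᵥ J := by
    rw [← Matrix.mulVec_mulVec, hA]
  rw [GradOp_adjoint_mul_DeltaA n M a] at key
  simp only [Matrix.add_mulVec, Matrix.smul_mulVec, ← Matrix.mulVec_mulVec] at key
  rw [Matrix.sub_mulVec, Matrix.one_mulVec, Matrix.mulVec_sub, divS_QvAdj] at key
  have hLP : LapS (fine n M) (n : ℂ) *ᵥ (PcT n M (n : ℂ) *ᵥ ((GradOp (fine n M) (n : ℂ))ᴴ *ᵥ A))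
      = QsAdj n M *ᵥ (Einv n M *ᵥ (QsOp n M *ᵥ (LapSinv (fine n M) (n : ℂ) *ᵥ
          ((GradOp (fine n M) (n : ℂ))ᴴ *ᵥ A)))) := by
    rw [PcT_mulVec, LapS_LapSinv_of_orth (fine n M) hnc _ (QsOp_adjoint_orth n M _
      (sum_Minv_of_orth n M (n : ℂ) hnc _ (sum_QsOp_LapSinv n M (n : ℂ) _))), QsAdj_Einv]
  rw [hLP] at key
  exact key

/-- **(1.80)** «Q′Δ⁻¹∂*A = (∂₁*φ⁻¹∂₁)⁻¹[a⁻¹(Q′Δ⁻²Q′*)⁻¹Q′Δ⁻²∂*J − ∂₁*φ⁻¹QΔ⁻¹J]» for `Δ_aA = J`,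
`A ⊥` constants, `a > 0` — obtained as printed: (1.77) substituted into the divergence of (1.73), `Q′Δ⁻¹`
applied ((1.78)–(1.79)), and «(∂₁*φ⁻¹∂₁)⁻¹[…]». [cite: Balaban1984PropagatorsI, (1.78)–(1.80) pp.30–31] -/
theorem eq180 (ha : 0 < a) {A J : Tor (fine n M) × Fin d → ℂ} (hA : DeltaA n M a *ᵥ A = J)
    (hAo : OrthConst (fine n M) A) :
    QsOp n M *ᵥ (LapSinv (fine n M) (n : ℂ) *ᵥ ((GradOp (fine n M) (n : ℂ))ᴴ *ᵥ A))
      = GPhiEInv n M a *ᵥ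
          ((a : ℂ)⁻¹ • (Einv n M *ᵥ (QsOp n M *ᵥ (LapSinv (fine n M) (n : ℂ) *ᵥ
              (LapSinv (fine n M) (n : ℂ) *ᵥ ((GradOp (fine n M) (n : ℂ))ᴴ *ᵥ J)))))
            - (GradOp M 1)ᴴ *ᵥ (Phi176Inv n M a *ᵥ (QvOp n M *ᵥ (LapVinv n M *ᵥ J)))) := by
  have hnc : (n : ℂ) ≠ 0 := by exact_mod_cast NeZero.ne n
  have ha' : (a : ℂ) ≠ 0 := by exact_mod_cast ha.ne'
  -- names: `s = ∂*A`, `u = Q′Δ⁻¹s`, `X = ∂₁*φ⁻¹QΔ⁻¹J`, `W = Q′Δ⁻²∂*J`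
  set s : Tor (fine n M) → ℂ := (GradOp (fine n M) (n : ℂ))ᴴ *ᵥ A with hs
  set u : Tor M → ℂ := QsOp n M *ᵥ (LapSinv (fine n M) (n : ℂ) *ᵥ s) with hu
  set X : Tor M → ℂ := (GradOp M 1)ᴴ *ᵥ (Phi176Inv n M a *ᵥ (QvOp n M *ᵥ (LapVinv n M *ᵥ J))) with hX
  set W : Tor M → ℂ := QsOp n M *ᵥ (LapSinv (fine n M) (n : ℂ) *ᵥ (LapSinv (fine n M) (n : ℂ) *ᵥ
    ((GradOp (fine n M) (n : ℂ))ᴴ *ᵥ J))) with hW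
  have hs0 : ∑ x, s x = 0 := sum_GradOp_adjoint (fine n M) (n : ℂ) A
  have hu0 : ∑ y, u y = 0 := sum_QsOp_LapSinv n M (n : ℂ) s
  have hX0 : ∑ y, X y = 0 := sum_GradOp_adjoint M 1 _
  have hG0 : ∑ y, (GPhiE n M a *ᵥ u) y = 0 := sum_GPhiE n M a u
  -- (1.77) inserted into `∂₁*(QA)`
  have h177 : (GradOp M 1)ᴴ *ᵥ (QvOp n M *ᵥ A) = GPhiE n M a *ᵥ u + X := by
    rw [eq177 n M a ha.le hA hAo, Matrix.mulVec_add, GPhiE_mulVec]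
  -- the divergence of (1.73): `Δs = ∂*J + Q′*(E u) − a•Q′*(∂₁*φ⁻¹∂₁ u) − a•Q′*X`
  have h173 := divS_eq173 n M a hA
  rw [← hs, ← hu, h177, Matrix.mulVec_add, smul_add] at h173
  -- apply `Q′Δ⁻²`: `u = Q′Δ⁻²(Δs)`
  have hus : u = QsOp n M *ᵥ (LapSinv (fine n M) (n : ℂ) *ᵥ (LapSinv (fine n M) (n : ℂ) *ᵥ
      (LapS (fine n M) (n : ℂ) *ᵥ s))) := by
    rw [LapSinv_LapS_of_orth (fine n M) hnc s hs0]
  have hΔs : LapS (fine n M) (n : ℂ) *ᵥ s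
      = (GradOp (fine n M) (n : ℂ))ᴴ *ᵥ J + QsAdj n M *ᵥ (Einv n M *ᵥ u)
        - (a : ℂ) • (QsAdj n M *ᵥ (GPhiE n M a *ᵥ u)) - (a : ℂ) • (QsAdj n M *ᵥ X) := by
    rw [← h173]
    abel
  have h179 : u = W + u - (a : ℂ) • (QsOp n M *ᵥ (LapSinv (fine n M) (n : ℂ) *ᵥ
        (LapSinv (fine n M) (n : ℂ) *ᵥ (QsAdj n M *ᵥ (GPhiE n M a *ᵥ u)))))
      - (a : ℂ) • (QsOp n M *ᵥ (LapSinv (fine n M) (n : ℂ) *ᵥ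
        (LapSinv (fine n M) (n : ℂ) *ᵥ (QsAdj n M *ᵥ X)))) := by
    conv_lhs => rw [hus, hΔs]
    simp only [Matrix.mulVec_add, Matrix.mulVec_sub, Matrix.mulVec_smul]
    rw [QsOp_LapSinv2_QsAdj_Einv n M u hu0]
  -- hence `a•Q′Δ⁻²Q′*(∂₁*φ⁻¹∂₁ u) = W − a•Q′Δ⁻²Q′*X`; apply `(Q′Δ⁻²Q′*)⁻¹`
  have h3 : (a : ℂ) • (QsOp n M *ᵥ (LapSinv (fine n M) (n : ℂ) *ᵥ
        (LapSinv (fine n M) (n : ℂ) *ᵥ (QsAdj n M *ᵥ (GPhiE n M a *ᵥ u)))))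
      = W - (a : ℂ) • (QsOp n M *ᵥ (LapSinv (fine n M) (n : ℂ) *ᵥ
        (LapSinv (fine n M) (n : ℂ) *ᵥ (QsAdj n M *ᵥ X)))) := by
    rw [← sub_eq_zero]
    have e : (a : ℂ) • (QsOp n M *ᵥ (LapSinv (fine n M) (n : ℂ) *ᵥ
          (LapSinv (fine n M) (n : ℂ) *ᵥ (QsAdj n M *ᵥ (GPhiE n M a *ᵥ u)))))
        - (W - (a : ℂ) • (QsOp n M *ᵥ (LapSinv (fine n M) (n : ℂ) *ᵥ
          (LapSinv (fine n M) (n : ℂ) *ᵥ (QsAdj n M *ᵥ X)))))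
        = -((W + u - (a : ℂ) • (QsOp n M *ᵥ (LapSinv (fine n M) (n : ℂ) *ᵥ
            (LapSinv (fine n M) (n : ℂ) *ᵥ (QsAdj n M *ᵥ (GPhiE n M a *ᵥ u)))))
          - (a : ℂ) • (QsOp n M *ᵥ (LapSinv (fine n M) (n : ℂ) *ᵥ
            (LapSinv (fine n M) (n : ℂ) *ᵥ (QsAdj n M *ᵥ X))))) - u) := by abel
    rw [e, neg_eq_zero, sub_eq_zero]
    exact h179.symm
  have h4 : (a : ℂ) • (GPhiE n M a *ᵥ u) = Einv n M *ᵥ W - (a : ℂ) • X := by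
    have h' := congrArg (fun v => Einv n M *ᵥ v) h3
    simp only [Matrix.mulVec_smul, Matrix.mulVec_sub] at h'
    rw [Einv_QsOp_LapSinv2_QsAdj n M _ hG0, Einv_QsOp_LapSinv2_QsAdj n M _ hX0] at h'
    exact h'
  -- apply `(∂₁*φ⁻¹∂₁)⁻¹`
  have h5 : (a : ℂ) • u = GPhiEInv n M a *ᵥ (Einv n M *ᵥ W - (a : ℂ) • X) := by
    rw [← h4, Matrix.mulVec_smul, GPhiEInv_GPhiE_of_orth n M a ha.le u hu0]
  calc u = (a : ℂ)⁻¹ • ((a : ℂ) • u) := by rw [smul_smul, inv_mul_cancel₀ ha', one_smul]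
    _ = GPhiEInv n M a *ᵥ ((a : ℂ)⁻¹ • (Einv n M *ᵥ W) - X) := by
        rw [h5, ← Matrix.mulVec_smul, smul_sub, smul_smul, inv_mul_cancel₀ ha', one_smul]

/-- **the `∂*`-component of (1.78)** («Substituting it in (1.73) and applying Δ⁻¹»): for `Δ_aA = J`, `A ⊥`
constants, `a ≥ 0`, with `u = Q′Δ⁻¹∂*A` and `X = ∂₁*φ⁻¹QΔ⁻¹J`,
`∂*A = Δ⁻¹∂*J − aΔ⁻¹Q′*X + Δ⁻¹Q′*[(Q′Δ⁻²Q′*)⁻¹u − a(∂₁*φ⁻¹∂₁)u]`.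
[cite: Balaban1984PropagatorsI, (1.78) p.30] -/
theorem divS_eq178 (ha : 0 ≤ a) {A J : Tor (fine n M) × Fin d → ℂ} (hA : DeltaA n M a *ᵥ A = J)
    (hAo : OrthConst (fine n M) A) :
    (GradOp (fine n M) (n : ℂ))ᴴ *ᵥ A
      = LapSinv (fine n M) (n : ℂ) *ᵥ ((GradOp (fine n M) (n : ℂ))ᴴ *ᵥ J)
        - (a : ℂ) • (LapSinv (fine n M) (n : ℂ) *ᵥ (QsAdj n M *ᵥ ((GradOp M 1)ᴴ *ᵥ
            (Phi176Inv n M a *ᵥ (QvOp n M *ᵥ (LapVinv n M *ᵥ J))))))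
        + LapSinv (fine n M) (n : ℂ) *ᵥ (QsAdj n M *ᵥ
            (Einv n M *ᵥ (QsOp n M *ᵥ (LapSinv (fine n M) (n : ℂ) *ᵥ ((GradOp (fine n M) (n : ℂ))ᴴ *ᵥ A)))
              - (a : ℂ) • (GPhiE n M a *ᵥ (QsOp n M *ᵥ (LapSinv (fine n M) (n : ℂ) *ᵥ
                  ((GradOp (fine n M) (n : ℂ))ᴴ *ᵥ A)))))) := by
  have hnc : (n : ℂ) ≠ 0 := by exact_mod_cast NeZero.ne n
  set s : Tor (fine n M) → ℂ := (GradOp (fine n M) (n : ℂ))ᴴ *ᵥ A with hs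
  set u : Tor M → ℂ := QsOp n M *ᵥ (LapSinv (fine n M) (n : ℂ) *ᵥ s) with hu
  have hs0 : ∑ x, s x = 0 := sum_GradOp_adjoint (fine n M) (n : ℂ) A
  have h177 : (GradOp M 1)ᴴ *ᵥ (QvOp n M *ᵥ A)
      = GPhiE n M a *ᵥ u + (GradOp M 1)ᴴ *ᵥ (Phi176Inv n M a *ᵥ (QvOp n M *ᵥ (LapVinv n M *ᵥ J))) := by
    rw [eq177 n M a ha hA hAo, Matrix.mulVec_add, GPhiE_mulVec]
  have h173 := divS_eq173 n M a hA
  rw [← hs, ← hu, h177, Matrix.mulVec_add, smul_add] at h173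
  have hΔs : LapS (fine n M) (n : ℂ) *ᵥ s
      = (GradOp (fine n M) (n : ℂ))ᴴ *ᵥ J + QsAdj n M *ᵥ (Einv n M *ᵥ u)
        - (a : ℂ) • (QsAdj n M *ᵥ (GPhiE n M a *ᵥ u))
        - (a : ℂ) • (QsAdj n M *ᵥ ((GradOp M 1)ᴴ *ᵥ
            (Phi176Inv n M a *ᵥ (QvOp n M *ᵥ (LapVinv n M *ᵥ J))))) := by
    rw [← h173]
    abel
  calc s = LapSinv (fine n M) (n : ℂ) *ᵥ (LapS (fine n M) (n : ℂ) *ᵥ s) :=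
        (LapSinv_LapS_of_orth (fine n M) hnc s hs0).symm
    _ = _ := by
        rw [hΔs]
        simp only [Matrix.mulVec_add, Matrix.mulVec_sub, Matrix.mulVec_smul]
        abel

/-! ## §4 (1.94): `∂*GQ*` -/

/-- (1.80) at `J = Q*ω`, `ω ⊥` constants (`a > 0`): `Q′Δ⁻¹∂*GQ*ω = a⁻¹(∂₁*φ⁻¹∂₁)⁻¹∂₁*φ⁻¹ω` — the two
steps printed between the lines of (1.94): `(Q′Δ⁻²Q′*)⁻¹Q′Δ⁻²∂*Q* = ∂₁*` ((1.55)*) and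
`∂₁* − a∂₁*φ⁻¹QΔ⁻¹Q* = ∂₁*φ⁻¹` ((1.76)). [cite: Balaban1984PropagatorsI, (1.80) p.31, (1.94) p.33] -/
theorem eq180_QvAdj (ha : 0 < a) (ω : Tor M × Fin d → ℂ) (hω : OrthConst M ω) :
    QsOp n M *ᵥ (LapSinv (fine n M) (n : ℂ) *ᵥ ((GradOp (fine n M) (n : ℂ))ᴴ *ᵥ
        ((DeltaA n M a)⁻¹ *ᵥ (QvAdj n M *ᵥ ω))))
      = (a : ℂ)⁻¹ • (GPhiEInv n M a *ᵥ ((GradOp M 1)ᴴ *ᵥ (Phi176Inv n M a *ᵥ ω))) := by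
  have hn : 1 ≤ n := Nat.one_le_iff_ne_zero.mpr (NeZero.ne n)
  have ha' : (a : ℂ) ≠ 0 := by exact_mod_cast ha.ne'
  have hdet := (Matrix.isUnit_iff_isUnit_det _).mp (isUnit_DeltaA n hn M a ha)
  have hA : DeltaA n M a *ᵥ ((DeltaA n M a)⁻¹ *ᵥ (QvAdj n M *ᵥ ω)) = QvAdj n M *ᵥ ω := by
    rw [Matrix.mulVec_mulVec, Matrix.mul_nonsing_inv _ hdet, Matrix.one_mulVec]
  have hAo := orthConst_of_DeltaA_eq n M a ha.ne' (orthConst_QvAdj n M hω) hA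
  rw [eq180 n M a ha hA hAo, divS_QvAdj, Einv_QsOp_LapSinv2_QsAdj n M _ (sum_GradOp_adjoint M 1 ω),
    ← PhiOp_mulVec]
  conv_rhs =>
    rw [Phi176Inv_eq_sub n M a ha.le ω, Matrix.mulVec_sub, Matrix.mulVec_smul, ← Matrix.mulVec_smul, smul_sub,
      smul_smul, inv_mul_cancel₀ ha', one_smul]

/-- **(1.94), `∂*GQ*` = its SECOND LINE**, on `ω ⊥` constants (`a > 0`):
`∂*GQ*ω = Δ⁻¹Q′*∂₁*φ⁻¹ω + Δ⁻¹Q′*[(Q′Δ⁻²Q′*)⁻¹ − a∂₁*φ⁻¹∂₁]·a⁻¹(∂₁*φ⁻¹∂₁)⁻¹·∂₁*φ⁻¹ω`.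
[cite: Balaban1984PropagatorsI, (1.94) p.33] -/
theorem divS_G_QvAdj_eq_line2_of_orth (ha : 0 < a) (ω : Tor M × Fin d → ℂ) (hω : OrthConst M ω) :
    (GradOp (fine n M) (n : ℂ))ᴴ *ᵥ ((DeltaA n M a)⁻¹ *ᵥ (QvAdj n M *ᵥ ω))
      = LapSinv (fine n M) (n : ℂ) *ᵥ (QsAdj n M *ᵥ ((GradOp M 1)ᴴ *ᵥ (Phi176Inv n M a *ᵥ ω)))
        + LapSinv (fine n M) (n : ℂ) *ᵥ (QsAdj n M *ᵥ ((Einv n M - (a : ℂ) • GPhiE n M a) *ᵥ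
            ((a : ℂ)⁻¹ • (GPhiEInv n M a *ᵥ ((GradOp M 1)ᴴ *ᵥ (Phi176Inv n M a *ᵥ ω)))))) := by
  have hn : 1 ≤ n := Nat.one_le_iff_ne_zero.mpr (NeZero.ne n)
  have hdet := (Matrix.isUnit_iff_isUnit_det _).mp (isUnit_DeltaA n hn M a ha)
  have hA : DeltaA n M a *ᵥ ((DeltaA n M a)⁻¹ *ᵥ (QvAdj n M *ᵥ ω)) = QvAdj n M *ᵥ ω := by
    rw [Matrix.mulVec_mulVec, Matrix.mul_nonsing_inv _ hdet, Matrix.one_mulVec]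
  have hAo := orthConst_of_DeltaA_eq n M a ha.ne' (orthConst_QvAdj n M hω) hA
  rw [divS_eq178 n M a ha.le hA hAo, eq180_QvAdj n M a ha ω hω, divS_QvAdj, ← PhiOp_mulVec,
    Matrix.sub_mulVec, Matrix.smul_mulVec]
  -- the first two terms: `Δ⁻¹Q′*∂₁*ω − aΔ⁻¹Q′*∂₁*φ⁻¹QΔ⁻¹Q*ω = Δ⁻¹Q′*∂₁*φ⁻¹ω`
  have h12 : LapSinv (fine n M) (n : ℂ) *ᵥ (QsAdj n M *ᵥ ((GradOp M 1)ᴴ *ᵥ ω))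
      - (a : ℂ) • (LapSinv (fine n M) (n : ℂ) *ᵥ (QsAdj n M *ᵥ ((GradOp M 1)ᴴ *ᵥ
          (Phi176Inv n M a *ᵥ (PhiOp n M *ᵥ ω)))))
      = LapSinv (fine n M) (n : ℂ) *ᵥ (QsAdj n M *ᵥ ((GradOp M 1)ᴴ *ᵥ (Phi176Inv n M a *ᵥ ω))) := by
    conv_rhs => rw [Phi176Inv_eq_sub n M a ha.le ω]
    rw [Matrix.mulVec_sub, Matrix.mulVec_smul, Matrix.mulVec_sub, Matrix.mulVec_smul, Matrix.mulVec_sub,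
      Matrix.mulVec_smul]
  rw [h12]

/-- **(1.94), SECOND LINE = THIRD LINE**, for every `ω` (`a > 0`): the `−a∂₁*φ⁻¹∂₁·a⁻¹(∂₁*φ⁻¹∂₁)⁻¹` part
returns `−Δ⁻¹Q′*∂₁*φ⁻¹ω` and cancels the first term (`∂₁*φ⁻¹ω ⊥ 1`).
[cite: Balaban1984PropagatorsI, (1.94) p.33] -/
theorem line2_eq_line3 (ha : 0 < a) (ω : Tor M × Fin d → ℂ) :
    LapSinv (fine n M) (n : ℂ) *ᵥ (QsAdj n M *ᵥ ((GradOp M 1)ᴴ *ᵥ (Phi176Inv n M a *ᵥ ω)))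
        + LapSinv (fine n M) (n : ℂ) *ᵥ (QsAdj n M *ᵥ ((Einv n M - (a : ℂ) • GPhiE n M a) *ᵥ
            ((a : ℂ)⁻¹ • (GPhiEInv n M a *ᵥ ((GradOp M 1)ᴴ *ᵥ (Phi176Inv n M a *ᵥ ω))))))
      = LapSinv (fine n M) (n : ℂ) *ᵥ (QsAdj n M *ᵥ (Einv n M *ᵥ
          ((a : ℂ)⁻¹ • (GPhiEInv n M a *ᵥ ((GradOp M 1)ᴴ *ᵥ (Phi176Inv n M a *ᵥ ω)))))) := by
  have ha' : (a : ℂ) ≠ 0 := by exact_mod_cast ha.ne'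
  have ht : ∑ y, ((GradOp M 1)ᴴ *ᵥ (Phi176Inv n M a *ᵥ ω)) y = 0 := sum_GradOp_adjoint M 1 _
  rw [Matrix.sub_mulVec, Matrix.smul_mulVec, Matrix.mulVec_smul (GPhiE n M a), smul_smul,
    mul_inv_cancel₀ ha', one_smul, GPhiE_GPhiEInv_of_orth n M a ha.le _ ht, Matrix.mulVec_sub,
    Matrix.mulVec_sub]
  abel

/-- **(1.94), FIRST LINE = SECOND LINE**, for every `ω` (`a ≥ 0`): «∂*Δ⁻¹Q* − a∂*Δ⁻¹Q*φ⁻¹QΔ⁻¹Q* +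
[Δ⁻¹Q′*(Q′Δ⁻²Q′*)⁻¹ − a∂*Δ⁻¹Q*φ⁻¹∂₁]·a⁻¹(∂₁*φ⁻¹∂₁)⁻¹[∂₁* − a∂₁*φ⁻¹QΔ⁻¹Q*] = Δ⁻¹Q′*∂₁*φ⁻¹ +
Δ⁻¹Q′*[(Q′Δ⁻²Q′*)⁻¹ − a∂₁*φ⁻¹∂₁]·a⁻¹(∂₁*φ⁻¹∂₁)⁻¹·∂₁*φ⁻¹» — by `∂*Δ⁻¹Q* = Δ⁻¹Q′*∂₁*` ((1.55)*,
`∂*Δ⁻¹ = Δ⁻¹∂*`) and `I − aφ⁻¹QΔ⁻¹Q* = φ⁻¹` ((1.76)). [cite: Balaban1984PropagatorsI, (1.94) p.33] -/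
theorem line1_eq_line2 (ha : 0 ≤ a) (ω : Tor M × Fin d → ℂ) :
    (GradOp (fine n M) (n : ℂ))ᴴ *ᵥ (LapVinv n M *ᵥ (QvAdj n M *ᵥ ω))
        - (a : ℂ) • ((GradOp (fine n M) (n : ℂ))ᴴ *ᵥ (LapVinv n M *ᵥ (QvAdj n M *ᵥ
            (Phi176Inv n M a *ᵥ (QvOp n M *ᵥ (LapVinv n M *ᵥ (QvAdj n M *ᵥ ω)))))))
        + (LapSinv (fine n M) (n : ℂ) *ᵥ (QsAdj n M *ᵥ (Einv n M *ᵥ ((a : ℂ)⁻¹ • (GPhiEInv n M a *ᵥ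
              ((GradOp M 1)ᴴ *ᵥ ω - (a : ℂ) • ((GradOp M 1)ᴴ *ᵥ
                (Phi176Inv n M a *ᵥ (QvOp n M *ᵥ (LapVinv n M *ᵥ (QvAdj n M *ᵥ ω))))))))))
        - (a : ℂ) • ((GradOp (fine n M) (n : ℂ))ᴴ *ᵥ (LapVinv n M *ᵥ (QvAdj n M *ᵥ
            (Phi176Inv n M a *ᵥ (GradOp M 1 *ᵥ ((a : ℂ)⁻¹ • (GPhiEInv n M a *ᵥ
              ((GradOp M 1)ᴴ *ᵥ ω - (a : ℂ) • ((GradOp M 1)ᴴ *ᵥ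
                (Phi176Inv n M a *ᵥ (QvOp n M *ᵥ (LapVinv n M *ᵥ (QvAdj n M *ᵥ ω))))))))))))))
      = LapSinv (fine n M) (n : ℂ) *ᵥ (QsAdj n M *ᵥ ((GradOp M 1)ᴴ *ᵥ (Phi176Inv n M a *ᵥ ω)))
        + LapSinv (fine n M) (n : ℂ) *ᵥ (QsAdj n M *ᵥ ((Einv n M - (a : ℂ) • GPhiE n M a) *ᵥ
            ((a : ℂ)⁻¹ • (GPhiEInv n M a *ᵥ ((GradOp M 1)ᴴ *ᵥ (Phi176Inv n M a *ᵥ ω)))))) := by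
  -- `[∂₁* − a∂₁*φ⁻¹QΔ⁻¹Q*]ω = ∂₁*φ⁻¹ω`
  have hbr : (GradOp M 1)ᴴ *ᵥ ω - (a : ℂ) • ((GradOp M 1)ᴴ *ᵥ
        (Phi176Inv n M a *ᵥ (QvOp n M *ᵥ (LapVinv n M *ᵥ (QvAdj n M *ᵥ ω)))))
      = (GradOp M 1)ᴴ *ᵥ (Phi176Inv n M a *ᵥ ω) := by
    rw [← PhiOp_mulVec]
    conv_rhs => rw [Phi176Inv_eq_sub n M a ha ω]
    rw [Matrix.mulVec_sub, Matrix.mulVec_smul]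
  -- `∂*Δ⁻¹Q*v = Δ⁻¹Q′*∂₁*v`
  have hdLQ : ∀ v : Tor M × Fin d → ℂ, (GradOp (fine n M) (n : ℂ))ᴴ *ᵥ (LapVinv n M *ᵥ (QvAdj n M *ᵥ v))
      = LapSinv (fine n M) (n : ℂ) *ᵥ (QsAdj n M *ᵥ ((GradOp M 1)ᴴ *ᵥ v)) := fun v => by
    rw [divS_LapVinv, divS_QvAdj]
  rw [hbr, hdLQ, hdLQ, hdLQ, ← PhiOp_mulVec, ← GPhiE_mulVec, Matrix.sub_mulVec, Matrix.smul_mulVec]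
  -- first two terms
  have h12 : LapSinv (fine n M) (n : ℂ) *ᵥ (QsAdj n M *ᵥ ((GradOp M 1)ᴴ *ᵥ ω))
      - (a : ℂ) • (LapSinv (fine n M) (n : ℂ) *ᵥ (QsAdj n M *ᵥ ((GradOp M 1)ᴴ *ᵥ
          (Phi176Inv n M a *ᵥ (PhiOp n M *ᵥ ω)))))
      = LapSinv (fine n M) (n : ℂ) *ᵥ (QsAdj n M *ᵥ ((GradOp M 1)ᴴ *ᵥ (Phi176Inv n M a *ᵥ ω))) := by
    conv_rhs => rw [Phi176Inv_eq_sub n M a ha ω]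
    rw [Matrix.mulVec_sub, Matrix.mulVec_smul, Matrix.mulVec_sub, Matrix.mulVec_smul, Matrix.mulVec_sub,
      Matrix.mulVec_smul]
  rw [h12]
  simp only [Matrix.mulVec_sub, Matrix.mulVec_smul]

/-- **(1.94), `∂*GQ*` = its THIRD LINE**, on `ω ⊥` constants (`a > 0`).
[cite: Balaban1984PropagatorsI, (1.94) p.33] -/
theorem divS_G_QvAdj_eq_line3_of_orth (ha : 0 < a) (ω : Tor M × Fin d → ℂ) (hω : OrthConst M ω) :
    (GradOp (fine n M) (n : ℂ))ᴴ *ᵥ ((DeltaA n M a)⁻¹ *ᵥ (QvAdj n M *ᵥ ω))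
      = LapSinv (fine n M) (n : ℂ) *ᵥ (QsAdj n M *ᵥ (Einv n M *ᵥ
          ((a : ℂ)⁻¹ • (GPhiEInv n M a *ᵥ ((GradOp M 1)ᴴ *ᵥ (Phi176Inv n M a *ᵥ ω)))))) := by
  rw [divS_G_QvAdj_eq_line2_of_orth n M a ha ω hω, line2_eq_line3 n M a ha ω]

/-- the third line of (1.94) vanishes on constant configurations (`φ⁻¹` fixes them, `∂₁*` kills them).
[cite: Balaban1984PropagatorsI, p.33] -/
theorem line3_constV (ha : 0 ≤ a) (c : Fin d → ℂ) :
    LapSinv (fine n M) (n : ℂ) *ᵥ (QsAdj n M *ᵥ (Einv n M *ᵥ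
        ((a : ℂ)⁻¹ • (GPhiEInv n M a *ᵥ ((GradOp M 1)ᴴ *ᵥ (Phi176Inv n M a *ᵥ constV M c)))))) = 0 := by
  rw [Phi176Inv_constV n M a ha, divS_constV, Matrix.mulVec_zero, smul_zero, Matrix.mulVec_zero,
    Matrix.mulVec_zero, Matrix.mulVec_zero]

/-- **(1.94), `∂*GQ*` = its THIRD LINE, for EVERY `ω`** («acting on a constant configuration gives 0»
for both sides; `ω = ω′ + ω₀`). [cite: Balaban1984PropagatorsI, (1.94) p.33] -/
theorem divS_G_QvAdj_eq_line3 (ha : 0 < a) (ω : Tor M × Fin d → ℂ) :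
    (GradOp (fine n M) (n : ℂ))ᴴ *ᵥ ((DeltaA n M a)⁻¹ *ᵥ (QvAdj n M *ᵥ ω))
      = LapSinv (fine n M) (n : ℂ) *ᵥ (QsAdj n M *ᵥ (Einv n M *ᵥ
          ((a : ℂ)⁻¹ • (GPhiEInv n M a *ᵥ ((GradOp M 1)ᴴ *ᵥ (Phi176Inv n M a *ᵥ ω)))))) := by
  have hL0 : (GradOp (fine n M) (n : ℂ))ᴴ *ᵥ ((DeltaA n M a)⁻¹ *ᵥ (QvAdj n M *ᵥ B0 M ω)) = 0 :=
    divS_G_QvAdj_constV n M a ha _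
  have hR0 : LapSinv (fine n M) (n : ℂ) *ᵥ (QsAdj n M *ᵥ (Einv n M *ᵥ
      ((a : ℂ)⁻¹ • (GPhiEInv n M a *ᵥ ((GradOp M 1)ᴴ *ᵥ (Phi176Inv n M a *ᵥ B0 M ω)))))) = 0 :=
    line3_constV n M a ha.le _
  conv_lhs => rw [← Bp_add_B0 M ω]
  conv_rhs => rw [← Bp_add_B0 M ω]
  simp only [Matrix.mulVec_add, smul_add]
  rw [hL0, hR0, divS_G_QvAdj_eq_line3_of_orth n M a ha _ (orthConst_Bp M ω)]

/-- **(1.94) AS A MATRIX IDENTITY** (final printed form):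
`∂*GQ* = Δ⁻¹Q′*(Q′Δ⁻²Q′*)⁻¹a⁻¹(∂₁*φ⁻¹∂₁)⁻¹∂₁*φ⁻¹` for the torus operators, `G = Δ_a⁻¹`, `a > 0`.
[cite: Balaban1984PropagatorsI, (1.94) p.33] -/
theorem eq194 (ha : 0 < a) :
    (GradOp (fine n M) (n : ℂ))ᴴ * (DeltaA n M a)⁻¹ * QvAdj n M
      = LapSinv (fine n M) (n : ℂ) * QsAdj n M * Einv n M * ((a : ℂ)⁻¹ • GPhiEInv n M a)
          * (GradOp M 1)ᴴ * Phi176Inv n M a :=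
  ext_of_mulVec' fun ω => by
    simp only [← Matrix.mulVec_mulVec, Matrix.smul_mulVec]
    exact divS_G_QvAdj_eq_line3 n M a ha ω

/-- **(1.94), all three printed lines agree with `∂*GQ*`**, for every `ω` (`a > 0`): `∂*GQ*ω =` line 1 `ω`
and `=` line 2 `ω`. [cite: Balaban1984PropagatorsI, (1.94) p.33] -/
theorem divS_G_QvAdj_eq_line1_and_line2 (ha : 0 < a) (ω : Tor M × Fin d → ℂ) :
    (GradOp (fine n M) (n : ℂ))ᴴ *ᵥ ((DeltaA n M a)⁻¹ *ᵥ (QvAdj n M *ᵥ ω))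
      = (GradOp (fine n M) (n : ℂ))ᴴ *ᵥ (LapVinv n M *ᵥ (QvAdj n M *ᵥ ω))
        - (a : ℂ) • ((GradOp (fine n M) (n : ℂ))ᴴ *ᵥ (LapVinv n M *ᵥ (QvAdj n M *ᵥ
            (Phi176Inv n M a *ᵥ (QvOp n M *ᵥ (LapVinv n M *ᵥ (QvAdj n M *ᵥ ω)))))))
        + (LapSinv (fine n M) (n : ℂ) *ᵥ (QsAdj n M *ᵥ (Einv n M *ᵥ ((a : ℂ)⁻¹ • (GPhiEInv n M a *ᵥ
              ((GradOp M 1)ᴴ *ᵥ ω - (a : ℂ) • ((GradOp M 1)ᴴ *ᵥ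
                (Phi176Inv n M a *ᵥ (QvOp n M *ᵥ (LapVinv n M *ᵥ (QvAdj n M *ᵥ ω))))))))))
        - (a : ℂ) • ((GradOp (fine n M) (n : ℂ))ᴴ *ᵥ (LapVinv n M *ᵥ (QvAdj n M *ᵥ
            (Phi176Inv n M a *ᵥ (GradOp M 1 *ᵥ ((a : ℂ)⁻¹ • (GPhiEInv n M a *ᵥ
              ((GradOp M 1)ᴴ *ᵥ ω - (a : ℂ) • ((GradOp M 1)ᴴ *ᵥ
                (Phi176Inv n M a *ᵥ (QvOp n M *ᵥ (LapVinv n M *ᵥ (QvAdj n M *ᵥ ω))))))))))))))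
    ∧ (GradOp (fine n M) (n : ℂ))ᴴ *ᵥ ((DeltaA n M a)⁻¹ *ᵥ (QvAdj n M *ᵥ ω))
      = LapSinv (fine n M) (n : ℂ) *ᵥ (QsAdj n M *ᵥ ((GradOp M 1)ᴴ *ᵥ (Phi176Inv n M a *ᵥ ω)))
        + LapSinv (fine n M) (n : ℂ) *ᵥ (QsAdj n M *ᵥ ((Einv n M - (a : ℂ) • GPhiE n M a) *ᵥ
            ((a : ℂ)⁻¹ • (GPhiEInv n M a *ᵥ ((GradOp M 1)ᴴ *ᵥ (Phi176Inv n M a *ᵥ ω)))))) := by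
  refine ⟨?_, ?_⟩
  · rw [line1_eq_line2 n M a ha.le ω, line2_eq_line3 n M a ha ω, divS_G_QvAdj_eq_line3 n M a ha ω]
  · rw [line2_eq_line3 n M a ha ω, divS_G_QvAdj_eq_line3 n M a ha ω]

/-! ## §5 (1.96): `∂*G∂` -/

/-- `(Q′Δ⁻²Q′*)⁻¹t ⊥ 1` for `t ⊥ 1` (the inverse «on this subspace», p. 22). [cite: Balaban1984PropagatorsI, Sect. C p.22] -/
theorem sum_Einv_of_orth (t : Tor M → ℂ) (ht : ∑ y, t y = 0) : ∑ y, (Einv n M *ᵥ t) y = 0 := by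
  have hnc : (n : ℂ) ≠ 0 := by exact_mod_cast NeZero.ne n
  rw [Einv, Matrix.smul_mulVec]
  simp only [Pi.smul_apply, smul_eq_mul, ← Finset.mul_sum, sum_Minv_of_orth n M (n : ℂ) hnc t ht,
    mul_zero]

/-- **(1.96) on scalars `λ ⊥ 1`** (`a > 0`): «∂*G∂λ = λ + Δ⁻¹Q′*[(Q′Δ⁻²Q′*)⁻¹a⁻¹(∂₁*φ⁻¹∂₁)⁻¹(Q′Δ⁻²Q′*)⁻¹
− 2(Q′Δ⁻²Q′*)⁻¹]Q′Δ⁻¹λ» — by (1.78)/(1.80) at `J = ∂λ`: `Q′Δ⁻²∂*∂λ = Q′Δ⁻¹λ`, `QΔ⁻¹∂λ = ∂₁Q′Δ⁻¹λ` ((1.55)),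
so `Q′Δ⁻¹∂*G∂λ = a⁻¹(∂₁*φ⁻¹∂₁)⁻¹(Q′Δ⁻²Q′*)⁻¹Q′Δ⁻¹λ − Q′Δ⁻¹λ`.
[cite: Balaban1984PropagatorsI, (1.96) p.33] -/
theorem eq196_mulVec_of_orth (ha : 0 < a) (lam : Tor (fine n M) → ℂ) (hlam : ∑ x, lam x = 0) :
    (GradOp (fine n M) (n : ℂ))ᴴ *ᵥ ((DeltaA n M a)⁻¹ *ᵥ (GradOp (fine n M) (n : ℂ) *ᵥ lam))
      = lam + LapSinv (fine n M) (n : ℂ) *ᵥ (QsAdj n M *ᵥ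
          (Einv n M *ᵥ ((a : ℂ)⁻¹ • (GPhiEInv n M a *ᵥ (Einv n M *ᵥ
              (QsOp n M *ᵥ (LapSinv (fine n M) (n : ℂ) *ᵥ lam)))))
            - (2 : ℂ) • (Einv n M *ᵥ (QsOp n M *ᵥ (LapSinv (fine n M) (n : ℂ) *ᵥ lam))))) := by
  have hn : 1 ≤ n := Nat.one_le_iff_ne_zero.mpr (NeZero.ne n)
  have hnc : (n : ℂ) ≠ 0 := by exact_mod_cast NeZero.ne n
  have ha' : (a : ℂ) ≠ 0 := by exact_mod_cast ha.ne'
  have hdet := (Matrix.isUnit_iff_isUnit_det _).mp (isUnit_DeltaA n hn M a ha)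
  have hA : DeltaA n M a *ᵥ ((DeltaA n M a)⁻¹ *ᵥ (GradOp (fine n M) (n : ℂ) *ᵥ lam))
      = GradOp (fine n M) (n : ℂ) *ᵥ lam := by
    rw [Matrix.mulVec_mulVec, Matrix.mul_nonsing_inv _ hdet, Matrix.one_mulVec]
  have hAo := orthConst_of_DeltaA_eq n M a ha.ne' (orthConst_GradOp (fine n M) (n : ℂ) lam) hA
  -- `v = Q′Δ⁻¹λ ⊥ 1`
  set v : Tor M → ℂ := QsOp n M *ᵥ (LapSinv (fine n M) (n : ℂ) *ᵥ lam) with hv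
  have hv0 : ∑ y, v y = 0 := sum_QsOp_LapSinv n M (n : ℂ) lam
  have hEv0 : ∑ y, (Einv n M *ᵥ v) y = 0 := sum_Einv_of_orth n M v hv0
  -- the printed pieces at `J = ∂λ`
  have hdJ : (GradOp (fine n M) (n : ℂ))ᴴ *ᵥ (GradOp (fine n M) (n : ℂ) *ᵥ lam)
      = LapS (fine n M) (n : ℂ) *ᵥ lam := divS_GradOp_mulVec (fine n M) (n : ℂ) lam
  have hW : QsOp n M *ᵥ (LapSinv (fine n M) (n : ℂ) *ᵥ (LapSinv (fine n M) (n : ℂ) *ᵥ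
      ((GradOp (fine n M) (n : ℂ))ᴴ *ᵥ (GradOp (fine n M) (n : ℂ) *ᵥ lam)))) = v := by
    rw [hdJ, LapSinv_LapS_of_orth (fine n M) hnc lam hlam]
  have hQJ : QvOp n M *ᵥ (LapVinv n M *ᵥ (GradOp (fine n M) (n : ℂ) *ᵥ lam)) = GradOp M 1 *ᵥ v := by
    rw [LapVinv_GradOp, QvOp_GradOp_mulVec]
  -- (1.80) at `J = ∂λ`: `u = a⁻¹(∂₁*φ⁻¹∂₁)⁻¹(Q′Δ⁻²Q′*)⁻¹v − v`
  have hu : QsOp n M *ᵥ (LapSinv (fine n M) (n : ℂ) *ᵥ ((GradOp (fine n M) (n : ℂ))ᴴ *ᵥ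
        ((DeltaA n M a)⁻¹ *ᵥ (GradOp (fine n M) (n : ℂ) *ᵥ lam))))
      = (a : ℂ)⁻¹ • (GPhiEInv n M a *ᵥ (Einv n M *ᵥ v)) - v := by
    rw [eq180 n M a ha hA hAo, hW, hQJ, ← GPhiE_mulVec, Matrix.mulVec_sub, Matrix.mulVec_smul,
      GPhiEInv_GPhiE_of_orth n M a ha.le v hv0]
  -- (1.78) at `J = ∂λ`
  rw [divS_eq178 n M a ha.le hA hAo, hu, hdJ, LapSinv_LapS_of_orth (fine n M) hnc lam hlam, hQJ,
    ← GPhiE_mulVec]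
  -- `a(∂₁*φ⁻¹∂₁)(a⁻¹(∂₁*φ⁻¹∂₁)⁻¹(Ev) − v) = Ev − a(∂₁*φ⁻¹∂₁)v`
  have hG : (a : ℂ) • (GPhiE n M a *ᵥ ((a : ℂ)⁻¹ • (GPhiEInv n M a *ᵥ (Einv n M *ᵥ v)) - v))
      = Einv n M *ᵥ v - (a : ℂ) • (GPhiE n M a *ᵥ v) := by
    rw [Matrix.mulVec_sub, Matrix.mulVec_smul, GPhiE_GPhiEInv_of_orth n M a ha.le _ hEv0, smul_sub,
      smul_smul, mul_inv_cancel₀ ha', one_smul]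
  rw [hG, Matrix.mulVec_sub, Matrix.mulVec_smul, two_smul]
  simp only [Matrix.mulVec_add, Matrix.mulVec_sub, Matrix.mulVec_smul]
  abel

/-- the right-hand side of (1.96) (with `I` the identity) on a CONSTANT `c`: it is `c` itself, while `∂*G∂c = 0`
— so (1.96) is an identity on the subspace «orthogonal to constant configurations» (p. 33), i.e. with `I`
read as `I − P_const` on all of `L²(T_η)`. [cite: Balaban1984PropagatorsI, (1.96) p.33] -/
theorem eq196_const_parts (c : ℂ) :
    (GradOp (fine n M) (n : ℂ))ᴴ *ᵥ ((DeltaA n M a)⁻¹ *ᵥ (GradOp (fine n M) (n : ℂ) *ᵥ fun _ => c)) = 0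
    ∧ QsOp n M *ᵥ (LapSinv (fine n M) (n : ℂ) *ᵥ fun _ : Tor (fine n M) => c) = 0
    ∧ Pker (fine n M) (n : ℂ) *ᵥ (fun _ : Tor (fine n M) => c) = fun _ => c := by
  have hg : GradOp (fine n M) (n : ℂ) *ᵥ (fun _ : Tor (fine n M) => c) = 0 := by
    funext ⟨x, ν⟩
    rw [GradOp_mulVec, sdiff_const]
    rfl
  refine ⟨?_, ?_, ?_⟩
  · rw [hg, Matrix.mulVec_zero, Matrix.mulVec_zero]
  · rw [LapSinv_const, Matrix.mulVec_zero]
  · have h : (1 - Pker (fine n M) (n : ℂ)) *ᵥ (fun _ : Tor (fine n M) => c) = 0 := by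
      rw [← LapSinv_mul_LapS, ← Matrix.mulVec_mulVec, B5LaplaceSpectral.LapS_const, Matrix.mulVec_zero]
    rw [Matrix.sub_mulVec, Matrix.one_mulVec, sub_eq_zero] at h
    exact h.symm

/-- **(1.96) AS A MATRIX IDENTITY on all of `L²(T_η)`** (`a > 0`):
`∂*G∂ = (I − P_const) + Δ⁻¹Q′*[(Q′Δ⁻²Q′*)⁻¹a⁻¹(∂₁*φ⁻¹∂₁)⁻¹(Q′Δ⁻²Q′*)⁻¹ − 2(Q′Δ⁻²Q′*)⁻¹]Q′Δ⁻¹` — the printed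
`I` on the subspace of p. 33, `0` on constants. [cite: Balaban1984PropagatorsI, (1.96) p.33] -/
theorem eq196 (ha : 0 < a) :
    (GradOp (fine n M) (n : ℂ))ᴴ * (DeltaA n M a)⁻¹ * GradOp (fine n M) (n : ℂ)
      = (1 - Pker (fine n M) (n : ℂ))
        + LapSinv (fine n M) (n : ℂ) * QsAdj n M
          * (Einv n M * ((a : ℂ)⁻¹ • GPhiEInv n M a) * Einv n M - (2 : ℂ) • Einv n M)
          * QsOp n M * LapSinv (fine n M) (n : ℂ) := by
  have hnc : (n : ℂ) ≠ 0 := by exact_mod_cast NeZero.ne n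
  refine ext_of_mulVec' fun lam => ?_
  -- decompose `λ = λ′ + c`, `λ′ ⊥ 1`
  set c : ℂ := ((Fintype.card (Tor (fine n M)) : ℂ))⁻¹ * ∑ x, lam x with hc
  set lam' : Tor (fine n M) → ℂ := fun x => lam x - c with hlam'def
  have hl : lam = lam' + fun _ => c := by
    funext x
    simp only [hlam'def, Pi.add_apply, sub_add_cancel]
  have hl' : ∑ x, lam' x = 0 := by
    have hcard : ((Fintype.card (Tor (fine n M)) : ℂ)) ≠ 0 := Nat.cast_ne_zero.mpr Fintype.card_ne_zero
    simp only [hlam'def, Finset.sum_sub_distrib, Finset.sum_const, Finset.card_univ, nsmul_eq_mul, hc]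
    rw [← mul_assoc, mul_inv_cancel₀ hcard, one_mul, sub_self]
  obtain ⟨h0L, h0Q, h0P⟩ := eq196_const_parts n M a c
  rw [hl, Matrix.mulVec_add, Matrix.mulVec_add]
  have hL' : ((GradOp (fine n M) (n : ℂ))ᴴ * (DeltaA n M a)⁻¹ * GradOp (fine n M) (n : ℂ)) *ᵥ lam'
      = ((1 - Pker (fine n M) (n : ℂ))
        + LapSinv (fine n M) (n : ℂ) * QsAdj n M
          * (Einv n M * ((a : ℂ)⁻¹ • GPhiEInv n M a) * Einv n M - (2 : ℂ) • Einv n M)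
          * QsOp n M * LapSinv (fine n M) (n : ℂ)) *ᵥ lam' := by
    simp only [← Matrix.mulVec_mulVec, Matrix.add_mulVec, Matrix.sub_mulVec, Matrix.smul_mulVec,
      Matrix.one_mulVec]
    rw [eq196_mulVec_of_orth n M a ha lam' hl', Pker_orth (fine n M) hnc lam' hl', sub_zero]
  have hLc : ((GradOp (fine n M) (n : ℂ))ᴴ * (DeltaA n M a)⁻¹ * GradOp (fine n M) (n : ℂ)) *ᵥ (fun _ => c)
      = ((1 - Pker (fine n M) (n : ℂ))
        + LapSinv (fine n M) (n : ℂ) * QsAdj n M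
          * (Einv n M * ((a : ℂ)⁻¹ • GPhiEInv n M a) * Einv n M - (2 : ℂ) • Einv n M)
          * QsOp n M * LapSinv (fine n M) (n : ℂ)) *ᵥ (fun _ => c) := by
    simp only [← Matrix.mulVec_mulVec, Matrix.add_mulVec, Matrix.sub_mulVec, Matrix.smul_mulVec,
      Matrix.one_mulVec]
    rw [h0L, h0Q, h0P, sub_self, Matrix.mulVec_zero, Matrix.mulVec_zero, smul_zero, Matrix.mulVec_zero,
      smul_zero, sub_self, Matrix.mulVec_zero, Matrix.mulVec_zero, zero_add]
  rw [hL', hLc]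

/-! ## §6 (1.95) and (1.97) FROM (1.94) and (1.96), as printed

The matrix identities (1.95) `R∂*GQ* = 0`, `QG∂R = 0` and (1.97) `R∂*G∂ = ∂*G∂R = R` are ALREADY LANDED as
`B5Identities197Torus.eq195_left / eq195_right / eq197_left / eq197_right` (seat p21) and are not re-declared
here.  What this section adds is the printed REASON («so `RΔ⁻¹Q′* = 0`») as the theorems
`RT_mul_LapSinv_mul_QsAdj` / `QsOp_mul_LapSinv_mul_RT` (+ `R·P_const = P_const·R = 0`), and four kernel-checked
`example`s showing that, with them, (1.95) and (1.97) follow from (1.94) = `eq194` and (1.96) = `eq196` by the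
two-line computation of p. 33–34. -/

/-- **«so RΔ⁻¹Q′* = 0»** with `R` the p. 25 projection `RT = 1 − P − P_const` (`P_constΔ⁻¹ = 0`).
[cite: Balaban1984PropagatorsI, p.33 before (1.95), p.25] -/
theorem RT_mul_LapSinv_mul_QsAdj : RT n M * LapSinv (fine n M) (n : ℂ) * QsAdj n M = 0 := by
  rw [RT, Matrix.sub_mul, Pker_mul_LapSinv, sub_zero]
  exact oneSubPcT_LapSinv_QsAdj n M

/-- `Q′Δ⁻¹R = 0` (the adjoint of «RΔ⁻¹Q′* = 0»; `Q′* = n^d·(Q′)ᴴ`, `Δ⁻¹`, `R` Hermitian).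
[cite: Balaban1984PropagatorsI, p.33 before (1.95)] -/
theorem QsOp_mul_LapSinv_mul_RT : QsOp n M * LapSinv (fine n M) (n : ℂ) * RT n M = 0 := by
  have hnd : ((n : ℂ) ^ d) ≠ 0 := pow_ne_zero _ (by exact_mod_cast NeZero.ne n)
  have h := congrArg Matrix.conjTranspose (RT_mul_LapSinv_mul_QsAdj n M)
  rw [Matrix.conjTranspose_zero, Matrix.conjTranspose_mul, Matrix.conjTranspose_mul, QsAdj,
    Matrix.conjTranspose_smul, Matrix.conjTranspose_conjTranspose, LapSinv_conjTranspose, RT_conjTranspose,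
    star_pow, Complex.star_def, Complex.conj_natCast] at h
  have h' : ((n : ℂ) ^ d) • (QsOp n M * LapSinv (fine n M) (n : ℂ) * RT n M) = 0 := by
    simpa only [Matrix.smul_mul, Matrix.mul_assoc] using h
  exact (smul_eq_zero.mp h').resolve_left hnd

/-- `R·P_const = 0` for the p. 25 projection (`R = I − P − P_const`, `P·P_const = 0`; «an orthogonal projection on
the linear subspace ΔN(Q′_k)», which is `⊥ 1`). [cite: Balaban1984PropagatorsI, p.25] -/
theorem RT_mul_Pker : RT n M * Pker (fine n M) (n : ℂ) = 0 := by
  rw [RT, Matrix.sub_mul, Matrix.sub_mul, Matrix.one_mul, PcT_mul_Pker, Pker_mul_Pker, sub_zero, sub_self]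

/-- `P_const·R = 0` (adjoint of `R·P_const = 0`). [cite: Balaban1984PropagatorsI, p.25] -/
theorem Pker_mul_RT : Pker (fine n M) (n : ℂ) * RT n M = 0 := by
  have h := congrArg Matrix.conjTranspose (RT_mul_Pker n M)
  rwa [Matrix.conjTranspose_mul, Pker_conjTranspose, RT_conjTranspose, Matrix.conjTranspose_zero] at h

/- **(1.95), first identity, from (1.94)**: «so RΔ⁻¹Q′* = 0 and we have R∂*GQ* = 0» — the statement is
`B5Identities197Torus.eq195_left`; here it is OBTAINED from `eq194` by the printed computation. -/
example (ha : 0 < a) : RT n M * (GradOp (fine n M) (n : ℂ))ᴴ * (DeltaA n M a)⁻¹ * QvAdj n M = 0 := by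
  rw [Matrix.mul_assoc (RT n M), Matrix.mul_assoc (RT n M), eq194 n M a ha]
  simp only [← Matrix.mul_assoc]
  rw [RT_mul_LapSinv_mul_QsAdj]
  simp only [Matrix.zero_mul]

/- **(1.95), second identity**: «QG∂R = 0» — the adjoint of `R∂*GQ* = 0` (`G`, `R` Hermitian,
`(Q*)ᴴ = n^d·Q`); the statement is `B5Identities197Torus.eq195_right`. -/
example (ha : 0 < a) : QvOp n M * (DeltaA n M a)⁻¹ * GradOp (fine n M) (n : ℂ) * RT n M = 0 := by
  have hn : 1 ≤ n := Nat.one_le_iff_ne_zero.mpr (NeZero.ne n)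
  have hnd : ((n : ℂ) ^ d) ≠ 0 := pow_ne_zero _ (by exact_mod_cast NeZero.ne n)
  have hG : ((DeltaA n M a)⁻¹)ᴴ = (DeltaA n M a)⁻¹ := (B5Prop11Lattice.DeltaA_inv_isHermitian n hn M a ha).eq
  have h1 : RT n M * (GradOp (fine n M) (n : ℂ))ᴴ * (DeltaA n M a)⁻¹ * QvAdj n M = 0 := by
    rw [Matrix.mul_assoc (RT n M), Matrix.mul_assoc (RT n M), eq194 n M a ha]
    simp only [← Matrix.mul_assoc]
    rw [RT_mul_LapSinv_mul_QsAdj]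
    simp only [Matrix.zero_mul]
  have h := congrArg Matrix.conjTranspose h1
  rw [Matrix.conjTranspose_zero, Matrix.conjTranspose_mul, Matrix.conjTranspose_mul,
    Matrix.conjTranspose_mul, Matrix.conjTranspose_conjTranspose, QvAdj_conjTranspose, hG,
    RT_conjTranspose] at h
  have h' : ((n : ℂ) ^ d) • (QvOp n M * (DeltaA n M a)⁻¹ * GradOp (fine n M) (n : ℂ) * RT n M) = 0 := by
    simpa only [Matrix.smul_mul, Matrix.mul_assoc] using h
  exact (smul_eq_zero.mp h').resolve_left hnd

/- **(1.97), left form, from (1.96)**: «from this it follows that R∂*G∂ = R» — `R` kills `Δ⁻¹Q′*(…)`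
(«RΔ⁻¹Q′* = 0») and `R(I − P_const) = R`; the statement is `B5Identities197Torus.eq197_left`. -/
example (ha : 0 < a) :
    RT n M * (GradOp (fine n M) (n : ℂ))ᴴ * (DeltaA n M a)⁻¹ * GradOp (fine n M) (n : ℂ) = RT n M := by
  rw [Matrix.mul_assoc (RT n M), Matrix.mul_assoc (RT n M), eq196 n M a ha, Matrix.mul_add, Matrix.mul_sub,
    Matrix.mul_one, RT_mul_Pker, sub_zero]
  simp only [← Matrix.mul_assoc]
  rw [RT_mul_LapSinv_mul_QsAdj]
  simp only [Matrix.zero_mul, add_zero]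

/- **(1.97), right form, from (1.96)**: «∂*G∂R = R» — `Q′Δ⁻¹R = 0` kills the bracket, `(I − P_const)R = R`;
the statement is `B5Identities197Torus.eq197_right`. -/
example (ha : 0 < a) :
    (GradOp (fine n M) (n : ℂ))ᴴ * (DeltaA n M a)⁻¹ * GradOp (fine n M) (n : ℂ) * RT n M = RT n M := by
  rw [eq196 n M a ha, Matrix.add_mul, Matrix.sub_mul, Matrix.one_mul, Pker_mul_RT, sub_zero]
  simp only [Matrix.mul_assoc]
  rw [← Matrix.mul_assoc (QsOp n M), QsOp_mul_LapSinv_mul_RT]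
  simp only [Matrix.mul_zero, add_zero]

end

end Literature.MathematicalPhysics.QuantumFieldTheory.Balaban1983to89.B5Eq194DivG
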